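import Summits.BirchSwinnertonDyer.Rank1Residual.GaloisImage.KolyvaginPrimeTransverseSup
import Literature.NumberTheory.EllipticCurves.ZpExtensionUnramifiedProofs
import HarnessLib

/-!
# K6 crux `MuTransferX9` (stmt-BirchSwinnertonDyer-19276), CORE-PLAN S4.2 (file 1 of 3):
# `H¹(F, M) = H¹_ur ⊕ H¹_tr` for an unramified module at a tamely ramified level, the count
# `#H¹_tr = #M^{Γ_F}` with NO rank-one hypothesis, and the global → local Frobenius transfer
# (MU-TRANSFER-PROOF §2 Lemma 1 (ii), generic half)

Cell `bsd-smallim`, seat `bsd-smallim-koly` gen 7 (route `SmallImageMuTransfer`, rung K6, leaf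
`Rank1Residual.BSDpOnClassX9`). HONEST FRAMING: TOOL theorems of local Galois cohomology and linear
algebra; no definition, no named fact, no `sorry`; nothing is asserted about any curve and nothing is
booked; class X9 stays TYPED at class level. The file serves the OPEN registered stub `stub_coreX9` of
crux 19276 (skeleton v4 0154dd5daf38efd6) — item "S4.2 Lemma 1 (local theory at E-split q, depth
e_q = e) [OPEN, M] … to be matched to twistModP" of k6-c2's CORE-PLAN (evidence #12) — and credits
nothing toward its closure (`--supports … --as helper`). PARTITION (D-0054): X9 (A4) × p ∈ {5, 7}
(the statements are prime-generic, so also X10b ∧ ¬Surj at 3) — helper; closes NONE.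

## Content

* §1 For ANY non-archimedean local field `F` and ANY discrete `Γ_F`-module `M` on which the inertia
  group acts trivially, with the mod-`ℓ` cyclotomic character onto `(ℤ/ℓ)ˣ` on inertia (`hχI` —
  `F(μ_ℓ)/F` totally ramified; over `ℚ` the tree's cited fact `modPCyclotomicCharacter_surjOn_absInertia_rat`,
  Serre LF IV §4 Prop. 17): **`H¹_ur ⊓ H¹_tr = ⊥`** (`unramifiedSubgroup_inf_transverseSubgroup_cyclotomicField_eq_bot`:
  `Γ_F = I_F · ker χ̄_ℓ`, so an unramified cocycle principal on `ker χ̄_ℓ` is principal) — the half of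
  Rubin PCMI Prop. 1.9.5 (3) / [MR04] Lemma 1.2.4 the tree did not have; with x9's sup half
  (`unramifiedSubgroup_sup_transverseSubgroup_cyclotomicField_eq_top`, `M` finite killed by `ℓ − 1`) the
  DIRECT SUM (`isCompl_…`, `existsUnique_add_of_unramified_transverse`, `natCard_galoisCohomology_one_eq_mul`);
  and the count **`#H¹_tr = #M^{Γ_F} = #H¹_ur`** (`= #M^{φ=1}` for a Frobenius `φ`; Rubin 1.9.5 (1)–(2)) —
  the LOCAL half of x9's `natCard_cyclotomicTransverse_of_mem_frobeniusClassPrimes` WITHOUT its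
  Frobenius-class / rank-one hypotheses, which is what the RANK-TWO `E`-split primes of Theorem A need
  (`H¹_ur ≅ H¹_tr ≅ 𝒯_e ≅ (Ω/T^e)²`, KOLY-MEMO Lemma 5.6.1).
* §5 **Global → local Frobenius transfer** (`exists_isAbsArithFrob_conj_of_isArithFrobAt`): an arithmetic
  Frobenius `σ ∈ Γ_K` at `𝔔 ∣ q` (Chebotarev's output, k6-ty p432909) gives a local Frobenius `φ` of
  `K_q` with `ρ(res φ)` a `ρ(Γ_K)`-conjugate of `ρ(σ)` (for `ρ` unramified at `q`) and `κ(res φ) = κ(σ)`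
  for any `ℤ_p`-extension `κ` (`q ∤ p`; Washington Prop. 13.2 via the tree's `inertia_le_kerSubgroup_holds`)
  — x9's transport pattern of `natCard_invariants_toLocal_of_mem_frobeniusClassPrimes` made reusable; so
  "`q` is `E`-split" and "depth `m`" pass from `σ` to `φ` (`exists_isAbsArithFrob_split_of_isArithFrobAt`).

Files 2–3 (`…X9LocalTwistOperator`, `…X9LocalSplitPrime`): (F5) on the coordinate module, the local twist
`𝒯_J|_{Γ_{K_q}}` at an `E`-split prime, the assembly.

References: HOME/koly/MU-TRANSFER-PROOF.md §2 Lemma 1 (referee PASS v4–v13); K. Rubin, *Euler systems and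
Kolyvagin systems* (PCMI 18, 2011) Prop. 1.9.5 [Rubin2011]; B. Mazur, K. Rubin, *Kolyvagin systems*, Mem.
AMS 799 (2004) Lemmas 1.2.1, 1.2.4 [MazurRubin2004]; L. Washington, *Introduction to Cyclotomic Fields*,
Prop. 13.2 [Washington1997]; J.-P. Serre, *Local Fields* Ch. I §8, IV §4 [SerreLocalFields1979].
-/

set_option linter.dupNamespace false
set_option autoImplicit false

noncomputable section

open scoped Classical

universe u

namespace Summit.BirchSwinnertonDyer.BirchSwinnertonDyer.Rank1Residual.LocalSplitPrime

open CategoryTheory ContinuousCohomology Function Field ValuativeRel NumberField IsDedekindDomain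
open Literature.NumberTheory.GaloisRepresentations
open Literature.NumberTheory.GaloisRepresentations.IsNonarchimedeanLocalField
open _root_.TopRep
open Literature.NumberTheory.GaloisCohomology
open Summit.BirchSwinnertonDyer.Rank1Residual.GaloisImage
open Summit.BirchSwinnertonDyer.Rank1Residual (X11b.LocBridge.mem_unramifiedSubgroup_one_iff_forall_eq_zero)

/-! ## §1 Generic local theory: `H¹(F, M) = H¹_ur ⊕ H¹_tr` for an unramified `M` -/

section Generic

variable {F : Type u} [Field F] [ValuativeRel F] [TopologicalSpace F] [IsNonarchimedeanLocalField F]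
  {M : Type u} [AddCommGroup M] [TopologicalSpace M] [DiscreteTopology M]
  (ρF : DiscreteGaloisModule F M) (ℓ : ℕ) [Fact ℓ.Prime] [NeZero (ℓ : F)]

/-- **`H¹_ur(F, M) ⊓ H¹_tr(F, M) = 0`** (the missing half of Rubin PCMI Prop. 1.9.5 (3) /
[MR04] Lemma 1.2.4 in the tree): for a discrete `M` on which the inertia group `I_F` acts trivially and
`χ̄_ℓ` onto `(ℤ/ℓ)ˣ` already on `I_F`, a class that is both unramified (its cocycle vanishes on `I_F`) and
`F(μ_ℓ)`-transverse (its cocycle is principal on `ker χ̄_ℓ`) is zero: `Γ_F = I_F · ker χ̄_ℓ`, and on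
`g = t·k` the cocycle is `φ(t) + t·φ(k) = 0 + t(kx − x) = gx − x`.  No finiteness and no `(ℓ − 1)M = 0`
is needed for this half. [cite: Rubin2011, Prop. 1.9.5 (3) (p. 16)] [cite: MazurRubin2004, Lemma 1.2.4] -/
theorem unramifiedSubgroup_inf_transverseSubgroup_cyclotomicField_eq_bot
    (hI : ∀ t ∈ absInertia F, ∀ m : M, ρF t m = m)
    (hχI : ∀ u : (ZMod ℓ)ˣ, ∃ t ∈ absInertia F, modPCyclotomicCharacterZMod F ℓ t = u) :
    DiscreteGaloisModule.unramifiedSubgroup ρF 1 ⊓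
      DiscreteGaloisModule.transverseSubgroup ρF (CyclotomicField ℓ F) = ⊥ := by
  classical
  set χ := modPCyclotomicCharacterZMod F ℓ
  refine (AddSubgroup.eq_bot_iff_forall _).2 fun c hc => ?_
  obtain ⟨hur, htr⟩ := AddSubgroup.mem_inf.1 hc
  obtain ⟨φ, rfl⟩ := oneCocycleClass_surjective ρF.toTopRep c
  -- unramified: `φ` vanishes on the inertia group
  have h0 : ∀ t ∈ absInertia F, φ.1 t = 0 :=
    (X11b.LocBridge.mem_unramifiedSubgroup_one_iff_forall_eq_zero ρF hI φ).1 hur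
  -- transverse: `φ` is principal on `ker χ̄_ℓ`
  obtain ⟨x, hx⟩ := (mem_transverseSubgroup_cyclotomicField_iff ρF ℓ φ).1 htr
  -- hence principal on `Γ_F = I_F · ker χ̄_ℓ`
  refine (oneCocycleClass_eq_zero_iff _ φ).2 ⟨x, fun g => ?_⟩
  obtain ⟨t, ht, htg⟩ := hχI (χ g)
  have hk : χ (t⁻¹ * g) = 1 := by
    rw [map_mul, map_inv, htg, inv_mul_cancel]
  have hsplit : g = t * (t⁻¹ * g) := by rw [mul_inv_cancel_left]
  have h1 : φ.1 g = φ.1 t + ρF t (φ.1 (t⁻¹ * g)) := by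
    conv_lhs => rw [hsplit]
    exact φ.2 t (t⁻¹ * g)
  have h2 : ρF t (ρF (t⁻¹ * g) x) = ρF g x := by
    rw [← Module.End.mul_apply, ← map_mul, ← hsplit]
  rw [h1, h0 t ht, zero_add, hx _ hk, map_sub, h2, hI t ht x]
  rfl


/-- **`H¹_ur ⊕ H¹_tr = H¹(F, M)`** (Rubin PCMI Prop. 1.9.5 (3), BOTH halves; [MR04] Lemma 1.2.4) for a
finite unramified `M` killed by `ℓ − 1`, `ℓ` the residue characteristic, `χ̄_ℓ` onto on the inertia
group (`hχI`: `F(μ_ℓ)/F` totally ramified — Serre LF IV §4 Prop. 17 for `F = ℚ_ℓ`, the tree's fact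
`modPCyclotomicCharacter_surjOn_absInertia_rat`): the sup half is x9's
`unramifiedSubgroup_sup_transverseSubgroup_cyclotomicField_eq_top`, the inf half is
`unramifiedSubgroup_inf_transverseSubgroup_cyclotomicField_eq_bot`.
[cite: Rubin2011, Prop. 1.9.5 (3) (p. 16)] [cite: MazurRubin2004, Lemma 1.2.4] -/
theorem isCompl_unramifiedSubgroup_transverseSubgroup_cyclotomicField [Finite M]
    (hchar : ringChar 𝓀[F] = ℓ)
    (hI : ∀ t ∈ absInertia F, ∀ m : M, ρF t m = m)
    (hM : ∀ m : M, (ℓ - 1) • m = 0)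
    (hχI : ∀ u : (ZMod ℓ)ˣ, ∃ t ∈ absInertia F, modPCyclotomicCharacterZMod F ℓ t = u) :
    IsCompl (DiscreteGaloisModule.unramifiedSubgroup ρF 1)
      (DiscreteGaloisModule.transverseSubgroup ρF (CyclotomicField ℓ F)) :=
  ⟨disjoint_iff.2 (unramifiedSubgroup_inf_transverseSubgroup_cyclotomicField_eq_bot ρF ℓ hI hχI),
    codisjoint_iff.2
      (unramifiedSubgroup_sup_transverseSubgroup_cyclotomicField_eq_top ρF ℓ hchar hI hM hχI)⟩

/-- Every class is UNIQUELY an unramified class plus a transverse one (the direct sum as an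
existence-and-uniqueness statement). [cite: Rubin2011, Prop. 1.9.5 (3) (p. 16)] -/
theorem existsUnique_add_of_unramified_transverse [Finite M]
    (hchar : ringChar 𝓀[F] = ℓ)
    (hI : ∀ t ∈ absInertia F, ∀ m : M, ρF t m = m)
    (hM : ∀ m : M, (ℓ - 1) • m = 0)
    (hχI : ∀ u : (ZMod ℓ)ˣ, ∃ t ∈ absInertia F, modPCyclotomicCharacterZMod F ℓ t = u)
    (c : galoisCohomology ρF 1) :
    ∃! a : DiscreteGaloisModule.unramifiedSubgroup ρF 1,
      c - a ∈ DiscreteGaloisModule.transverseSubgroup ρF (CyclotomicField ℓ F) := by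
  have hc := isCompl_unramifiedSubgroup_transverseSubgroup_cyclotomicField ρF ℓ hchar hI hM hχI
  have htop : c ∈ DiscreteGaloisModule.unramifiedSubgroup ρF 1 ⊔
      DiscreteGaloisModule.transverseSubgroup ρF (CyclotomicField ℓ F) := by
    rw [hc.sup_eq_top]; trivial
  obtain ⟨a, ha, b, hb, rfl⟩ := AddSubgroup.mem_sup.1 htop
  refine ⟨⟨a, ha⟩, by simpa using hb, fun a' ha' => Subtype.ext ?_⟩
  -- `a + b - a'` transverse and `a - a'` unramified ⟹ `a - a' ∈ ur ⊓ tr = ⊥`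
  have h1 : (a : galoisCohomology ρF 1) - a' ∈ DiscreteGaloisModule.unramifiedSubgroup ρF 1 :=
    AddSubgroup.sub_mem _ ha a'.2
  have h2 : (a : galoisCohomology ρF 1) - a' ∈
      DiscreteGaloisModule.transverseSubgroup ρF (CyclotomicField ℓ F) := by
    have : a + b - (a' : galoisCohomology ρF 1) - b = a - a' := by abel
    rw [← this]
    exact AddSubgroup.sub_mem _ ha' hb
  have h0 : (a : galoisCohomology ρF 1) - a' ∈ DiscreteGaloisModule.unramifiedSubgroup ρF 1 ⊓
      DiscreteGaloisModule.transverseSubgroup ρF (CyclotomicField ℓ F) := AddSubgroup.mem_inf.2 ⟨h1, h2⟩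
  rw [hc.inf_eq_bot, AddSubgroup.mem_bot, sub_eq_zero] at h0
  exact h0.symm

/-- **`#H¹_tr(F, M) = #M^{Γ_F}`** for a finite unramified `M` killed by `ℓ − 1` with `χ̄_ℓ` onto on
inertia (Rubin PCMI Prop. 1.9.5 (1), `H¹_t(K, A) ≅ Hom(Gal(L/K), A^{ϕ=1})`, as a count; the local
half of x9's `natCard_cyclotomicTransverse_of_mem_frobeniusClassPrimes`, with no Frobenius-class
or rank-one hypothesis): `𝒯 ≅ H¹(Γ_F/ker χ̄_ℓ, M^{ker χ̄_ℓ})` (inflation–restriction), the quotient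
`≅ (ℤ/ℓ)ˣ` is cyclic of order `ℓ − 1` acting trivially on `M^{ker χ̄_ℓ} = M^{Γ_F}`, and
`#Hom(ℤ/(ℓ−1), M^{Γ_F}) = #M^{Γ_F}`. [cite: Rubin2011, Prop. 1.9.5 (1) (p. 16)] -/
theorem natCard_transverseSubgroup_cyclotomicField_eq_natCard_invariants [Finite M]
    (hI : ∀ t ∈ absInertia F, ∀ m : M, ρF t m = m)
    (hM : ∀ m : M, (ℓ - 1) • m = 0)
    (hχI : ∀ u : (ZMod ℓ)ˣ, ∃ t ∈ absInertia F, modPCyclotomicCharacterZMod F ℓ t = u) :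
    Nat.card (DiscreteGaloisModule.transverseSubgroup ρF (CyclotomicField ℓ F)) =
      Nat.card ρF.toTopRep.ρ.invariants := by
  classical
  haveI := absoluteGaloisGroup_compactSpace F
  rw [natCard_transverseSubgroup_cyclotomicField_eq ρF ℓ]
  -- the quotient `Γ_F / ker χ̄_ℓ ≃ (ℤ/ℓ)ˣ`: finite, discrete, cyclic of order `ℓ - 1`
  set χ := modPCyclotomicCharacterZMod F ℓ
  set H : Subgroup (absoluteGaloisGroup F) := χ.ker
  have hsurj : Function.Surjective χ := fun u => by
    obtain ⟨t, -, ht⟩ := hχI u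
    exact ⟨t, ht⟩
  let e : absoluteGaloisGroup F ⧸ H ≃* (ZMod ℓ)ˣ := QuotientGroup.quotientKerEquivOfSurjective χ hsurj
  haveI : Finite (absoluteGaloisGroup F ⧸ H) := Finite.of_equiv _ e.toEquiv.symm
  haveI : IsCyclic (absoluteGaloisGroup F ⧸ H) :=
    isCyclic_of_surjective e.symm.toMonoidHom e.symm.surjective
  have hcardQ : Nat.card (absoluteGaloisGroup F ⧸ H) = ℓ - 1 := by
    rw [Nat.card_congr e.toEquiv, Nat.card_eq_fintype_card, ZMod.card_units]
  haveI : H.FiniteIndex := Subgroup.finiteIndex_of_finite_quotient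
  have hHopen : IsOpen (H : Set (absoluteGaloisGroup F)) :=
    Subgroup.isOpen_of_isClosed_of_finiteIndex H (isClosed_ker_modPCyclotomicCharacterZMod ℓ)
  haveI : DiscreteTopology (absoluteGaloisGroup F ⧸ H) := QuotientGroup.discreteTopology hHopen
  -- the quotient acts trivially on `M^H = M^{Γ_F}`
  have htriv : ∀ (x : absoluteGaloisGroup F ⧸ H) (a : ρF.invariantsOf H),
      ContinuousRep.quotientInvariants H ρF x a = a := by
    intro x a
    obtain ⟨g, rfl⟩ := QuotientGroup.mk_surjective x
    apply Subtype.ext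
    rw [ContinuousRep.quotientInvariants_apply_coe]
    exact apply_eq_self_of_forall_ker ρF ℓ hI hχI g a.1
      (fun h hh => (ContinuousRep.mem_invariantsOf_iff H ρF a.1).1 a.2 ⟨h, hh⟩)
  rw [natCard_continuousCohomology_one_eq_natCard_addMonoidHom_of_trivial _ htriv,
    natCard_addMonoidHom_of_isCyclic, hcardQ]
  -- every element of `M^H` is killed by `ℓ - 1`
  have hall : ∀ a : ρF.invariantsOf H, ((ℓ - 1 : ℕ) : ℤ) • a = 0 := fun a => by
    apply Subtype.ext
    rw [Submodule.coe_smul, Submodule.coe_zero, natCast_zsmul]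
    exact hM a.1
  rw [Nat.card_congr (Equiv.subtypeUnivEquiv hall)]
  exact Nat.card_congr
    { toFun := fun a => ⟨a.1, fun g => apply_eq_self_of_forall_ker ρF ℓ hI hχI g a.1
        (fun h hh => (ContinuousRep.mem_invariantsOf_iff H ρF a.1).1 a.2 ⟨h, hh⟩)⟩
      invFun := fun v => ⟨v.1, (ContinuousRep.mem_invariantsOf_iff H ρF v.1).2 fun h => v.2 h.1⟩
      left_inv := fun _ => rfl
      right_inv := fun _ => rfl }

/-- Hence `#H¹_tr(F, M) = #H¹_ur(F, M)` (both `= #M^{Γ_F}`). [cite: Rubin2011, Prop. 1.9.5 (1)–(2) (p. 16)] -/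
theorem natCard_transverseSubgroup_cyclotomicField_eq_natCard_unramifiedSubgroup [Finite M]
    (hI : ∀ t ∈ absInertia F, ∀ m : M, ρF t m = m)
    (hM : ∀ m : M, (ℓ - 1) • m = 0)
    (hχI : ∀ u : (ZMod ℓ)ˣ, ∃ t ∈ absInertia F, modPCyclotomicCharacterZMod F ℓ t = u) :
    Nat.card (DiscreteGaloisModule.transverseSubgroup ρF (CyclotomicField ℓ F)) =
      Nat.card (DiscreteGaloisModule.unramifiedSubgroup ρF 1) := by
  rw [natCard_transverseSubgroup_cyclotomicField_eq_natCard_invariants ρF ℓ hI hM hχI,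
    natCard_unramifiedSubgroup_eq_natCard_invariants ρF hI]

/-- **`#H¹(F, M) = #H¹_ur · #H¹_tr`** (the direct sum, as a count). [cite: Rubin2011, Prop. 1.9.5 (3) (p. 16)] -/
theorem natCard_galoisCohomology_one_eq_mul [Finite M]
    (hchar : ringChar 𝓀[F] = ℓ)
    (hI : ∀ t ∈ absInertia F, ∀ m : M, ρF t m = m)
    (hM : ∀ m : M, (ℓ - 1) • m = 0)
    (hχI : ∀ u : (ZMod ℓ)ˣ, ∃ t ∈ absInertia F, modPCyclotomicCharacterZMod F ℓ t = u) :
    Nat.card (galoisCohomology ρF 1) =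
      Nat.card (DiscreteGaloisModule.unramifiedSubgroup ρF 1) *
        Nat.card (DiscreteGaloisModule.transverseSubgroup ρF (CyclotomicField ℓ F)) := by
  have hc := isCompl_unramifiedSubgroup_transverseSubgroup_cyclotomicField ρF ℓ hchar hI hM hχI
  set A := DiscreteGaloisModule.unramifiedSubgroup ρF 1
  set B := DiscreteGaloisModule.transverseSubgroup ρF (CyclotomicField ℓ F)
  -- `(a, b) ↦ a + b` is a bijection `A × B ≃ H¹`
  let f : A × B → galoisCohomology ρF 1 := fun ab => (ab.1 : galoisCohomology ρF 1) + ab.2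
  have hinj : Function.Injective f := by
    rintro ⟨a, b⟩ ⟨a', b'⟩ h
    change (a : galoisCohomology ρF 1) + b = a' + b' at h
    have h1 : (a : galoisCohomology ρF 1) - a' = b' - b := by
      rw [sub_eq_iff_eq_add, sub_add_eq_add_sub, eq_sub_iff_add_eq, h, add_comm]
    have hmem : (a : galoisCohomology ρF 1) - a' ∈ A ⊓ B :=
      AddSubgroup.mem_inf.2 ⟨AddSubgroup.sub_mem _ a.2 a'.2, h1 ▸ AddSubgroup.sub_mem _ b'.2 b.2⟩
    rw [hc.inf_eq_bot, AddSubgroup.mem_bot] at hmem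
    have ha : a = a' := Subtype.ext (sub_eq_zero.1 hmem)
    have hb : b = b' := by
      rw [hmem, eq_comm, sub_eq_zero] at h1
      exact Subtype.ext h1.symm
    rw [ha, hb]
  have hsurj : Function.Surjective f := fun c => by
    have htop : c ∈ A ⊔ B := by rw [hc.sup_eq_top]; trivial
    obtain ⟨a, ha, b, hb, rfl⟩ := AddSubgroup.mem_sup.1 htop
    exact ⟨(⟨a, ha⟩, ⟨b, hb⟩), rfl⟩
  rw [← Nat.card_congr (Equiv.ofBijective f ⟨hinj, hsurj⟩), Nat.card_prod]

/-- With an arithmetic Frobenius `φ`: **`#H¹_tr(F, M) = #M^{φ = 1}`** and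
**`#H¹_ur(F, M) = #(M ⧸ (φ − 1)M)`** ("values at `σ̄`" and "values at `Fr`", as counts).
[cite: Rubin2011, Prop. 1.9.5 (1)–(2) (p. 16)] [cite: MazurRubin2004, Lemma 1.2.1] -/
theorem natCard_transverseSubgroup_cyclotomicField_eq_natCard_fixedPoints [Finite M]
    (hI : ∀ t ∈ absInertia F, ∀ m : M, ρF t m = m)
    (hM : ∀ m : M, (ℓ - 1) • m = 0)
    (hχI : ∀ u : (ZMod ℓ)ˣ, ∃ t ∈ absInertia F, modPCyclotomicCharacterZMod F ℓ t = u)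
    {φ : absoluteGaloisGroup F} (hφ : IsFrobPow φ 1) :
    Nat.card (DiscreteGaloisModule.transverseSubgroup ρF (CyclotomicField ℓ F)) =
      Nat.card {m : M // ρF φ m = m} := by
  rw [natCard_transverseSubgroup_cyclotomicField_eq_natCard_invariants ρF ℓ hI hM hχI,
    natCard_invariants_eq_natCard_fixedPoints_of_isFrobPow ρF hI hφ]

end Generic

/-! ## §5 From a GLOBAL Frobenius at `𝔔 ∣ q` (Chebotarev's output) to a local Frobenius of `K_q` -/

section GlobalToLocal

open Literature.NumberTheory.EllipticCurves Literature.NumberTheory.Automorphic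

variable {K : Type u} [Field K] [NumberField K] {M : Type u} [AddCommGroup M] [TopologicalSpace M]
  [DiscreteTopology M] (ρ : DiscreteGaloisModule K M) {p : ℕ} [Fact p.Prime]
  (κ : ZpExtension K p) (q : HeightOneSpectrum (𝓞 K))

/-- **Global-to-local Frobenius transfer.**  Let `σ ∈ Γ_K` be an arithmetic Frobenius at a prime
`𝔔 ∣ q` of `\bar ℤ_K` (the output of Chebotarev, `exists_isArithFrobAt_mul_inv_mem_not_mem`), `ρ`
unramified at `q` and `q ∤ p`.  Then there is a local arithmetic Frobenius `φ` of `K_q` whose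
restriction to `K̄` acts on `M` as a `ρ(Γ_K)`-CONJUGATE of `ρ(σ)` and has THE SAME image as `σ`
under the (abelian, unramified-at-`q`) character `κ` — so "`ρ(σ) = 1`" (an `E`-split prime) and the
depth of `σ` in the `ℤ_p`-tower transfer to `φ` verbatim (x9's transport pattern of
`natCard_invariants_toLocal_of_mem_frobeniusClassPrimes`, made reusable).
[cite: SerreLocalFields1979, Ch. I §8] [cite: Washington1997, Prop. 13.2] -/
theorem exists_isAbsArithFrob_conj_of_isArithFrobAt (hunr : GaloisRep.IsUnramifiedAt q ρ)
    (hqp : (p : 𝓞 K) ∉ q.asIdeal) {𝔔 : Ideal (absIntegers (𝓞 K) K)} (h𝔔 : 𝔔 ∈ q.primesAbove)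
    {σ : absoluteGaloisGroup K} (hσ : IsArithFrobAt (𝓞 K) σ 𝔔) :
    ∃ (φ : absoluteGaloisGroup (q.adicCompletion K)) (g : absoluteGaloisGroup K), IsAbsArithFrob φ ∧
      ρ (absGaloisRestrict K (q.adicCompletion K) φ) = ρ g⁻¹ * ρ σ * ρ g ∧
      κ (absGaloisRestrict K (q.adicCompletion K) φ) = κ σ := by
  classical
  set L := q.adicCompletion K
  obtain ⟨φ, hφ⟩ := exists_isAbsArithFrob_holds L
  have hres : IsArithFrobAt (𝓞 K) (absGaloisRestrict K L φ) (adicCompletionPrime K q) :=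
    (isArithFrobAt_absGaloisRestrict_adicCompletionPrime_iff K q
      (by rw [residueFieldCard_adicCompletion_eq K q, HeightOneSpectrum.residueCard_eq_card_quotient]) φ).2 hφ
  haveI : 𝔔.IsPrime := h𝔔.1
  obtain ⟨g, hg⟩ := HeightOneSpectrum.exists_smul_eq_of_mem_primesAbove_holds
    (adicCompletionPrime_mem_primesAbove K q) h𝔔
  have hconj : IsArithFrobAt (𝓞 K) (g * absGaloisRestrict K L φ * g⁻¹) 𝔔 := hg ▸ hres.conj g
  have hin : σ * (g * absGaloisRestrict K L φ * g⁻¹)⁻¹ ∈ 𝔔.inertia (absoluteGaloisGroup K) :=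
    hσ.mul_inv_mem_inertia hconj
  -- `ρ` and `κ` kill that inertia element
  have hρ1 : ρ (σ * (g * absGaloisRestrict K L φ * g⁻¹)⁻¹) = 1 := hunr 𝔔 h𝔔 _ hin
  have hκ1 : κ (σ * (g * absGaloisRestrict K L φ * g⁻¹)⁻¹) = 1 :=
    ZpExtension.mem_kerSubgroup.1 (ZpExtension.inertia_le_kerSubgroup_holds K p κ hqp h𝔔 hin)
  refine ⟨φ, g, hφ, ?_, ?_⟩
  · have h1 : ρ σ = ρ (g * absGaloisRestrict K L φ * g⁻¹) := by
      have := apply_eq_apply_of_apply_mul_inv_eq_one ρ hρ1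
      exact this
    rw [h1, map_mul, map_mul, ← mul_assoc, ← mul_assoc, ← map_mul, inv_mul_cancel, map_one, one_mul,
      mul_assoc, ← map_mul, inv_mul_cancel, map_one, mul_one]
  · rw [map_mul, map_inv, mul_inv_eq_one] at hκ1
    rw [hκ1, map_mul, map_mul, map_inv, mul_comm (κ g), mul_assoc, mul_inv_cancel, mul_one]

/-- **Corollary (the `E`-split Chebotarev prime, locally).**  If moreover `ρ(σ) = 1` and `σ` has
depth `m` in the `ℤ_p`-tower (`σ ∈ Gal(K̄/K_m) ∖ Gal(K̄/K_{m+1})`), then some local Frobenius `φ` of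
`K_q` is `E`-split (`ρ(res φ) = 1`) of the same depth — the hypotheses of
`toLocal_twistModP_apply_eq_self_iff_of_split` / `natCard_transverse_toLocal_twistModP_of_split`.
[cite: SerreLocalFields1979, Ch. I §8] [cite: Washington1997, Prop. 13.2] -/
theorem exists_isAbsArithFrob_split_of_isArithFrobAt (hunr : GaloisRep.IsUnramifiedAt q ρ)
    (hqp : (p : 𝓞 K) ∉ q.asIdeal) {𝔔 : Ideal (absIntegers (𝓞 K) K)} (h𝔔 : 𝔔 ∈ q.primesAbove)
    {σ : absoluteGaloisGroup K} (hσ : IsArithFrobAt (𝓞 K) σ 𝔔) (hσ1 : ρ σ = 1) {m : ℕ}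
    (hσm : σ ∈ κ.layerSubgroup m) (hσm' : σ ∉ κ.layerSubgroup (m + 1)) :
    ∃ φ : absoluteGaloisGroup (q.adicCompletion K), IsAbsArithFrob φ ∧
      ρ (absGaloisRestrict K (q.adicCompletion K) φ) = 1 ∧
      absGaloisRestrict K (q.adicCompletion K) φ ∈ κ.layerSubgroup m ∧
      absGaloisRestrict K (q.adicCompletion K) φ ∉ κ.layerSubgroup (m + 1) := by
  obtain ⟨φ, g, hφ, hρ, hκ⟩ := exists_isAbsArithFrob_conj_of_isArithFrobAt ρ κ q hunr hqp h𝔔 hσ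
  refine ⟨φ, hφ, ?_, ?_, ?_⟩
  · rw [hρ, hσ1, mul_one, ← map_mul, inv_mul_cancel, map_one]
  · rw [ZpExtension.mem_layerSubgroup, hκ]; exact ZpExtension.mem_layerSubgroup.1 hσm
  · rw [ZpExtension.mem_layerSubgroup, hκ]; exact fun h => hσm' (ZpExtension.mem_layerSubgroup.2 h)

end GlobalToLocal

end Summit.BirchSwinnertonDyer.BirchSwinnertonDyer.Rank1Residual.LocalSplitPrime

end
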